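import Summits.QuantumFields.BalabanUV.Beta.GAN24.CubicPushGaugeLegUnfoldingFF
import Summits.QuantumFields.BalabanUV.Beta.WardLocusRecursive

/-!
# `BalabanUV.Beta.GAN24.CubicSectorLevelDown` — binder row G-an2-4 ∕ (CONV-C), the (S) row ∕ (W-γ) one level up, the (ζ-E) step:
# **THE SLOT SUM OF THE THREE-LEG UNFOLDING, AND THE CUBIC SECTOR OF THE SOURCE PAIRING AS THE SAME PAIRING ONE LEVEL DOWN AT THE RESPONSES —
# `X^{E}_{j+2}(h; n, φ)[S′] = cH_{j+1}·X_{j+1}(H_{j+1} h; H_{j+1} n, φ∘blk)[S′]`**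
# (G-an2-4 CRUX TEAM (2), seat `b2b-balaban-gan24-formalise-leaf-06` = the (γ) hand, gen 50, INTENT 2)

NOT IN PRINT; OUR BOOKKEEPING ([folklore] Fubini bookkeeping BY NAME over leaf-02 g61's PART 3 `CubicPushGaugeLegUnfoldingFF.hasSum_prod_gaugeLeg_e3OfK_ff` (the three-leg
unfolding for field–field stencil families, slot column outside), an2's `ValueJetGeneric.locStencil_e3OfK` (the cubic member is a local stencil family) and leaf-10's
`WardLocusRecursive.locStencil_SrecAt`; 0 `def`, 0 cited fact, 0 `def … : Prop`, 0 sorry).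
HONEST FRAMING (cell contract, verbatim): «discharging `BetaPertH` makes Bałaban's UV stability UNCONDITIONAL — a real constructive-QFT result; it is NOT the continuum limit and NOT
the Clay problem.»  HONEST DEPENDENCY (verbatim): «continuum YM on T⁴ ⇐ BetaPertH ∧ nine spine estimates (0/9 proved); BetaPertH ⇐ (D1) ∧ (D4) ∧ CAP+tail; G-an2-4 gates asym,
D1 and NE2/3/4.»

WHY.  Road-P2's source pairing one level up (B″ `GaugeReadSourcePairingSucc`, the `hX` of `ExplicitSourceFormLambdaShare.moments_sigmaPair_exit_succ_of_columnPairing`) is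
`X_{j+1}(h; n, φ) := Σ_l Σ'_t h l t·Σ'_{(u,x)} Σ_κ Σ_κ₂ n κ u·dzφ κ₂ x·e3OfK Lc G_j S_j l t u x (inl κ)(inl κ₂)` with the slot datum `h = colH G_{j+1}(e)`, `S_j = SrecAt j`.  PART 3 unfolds
ONE slot: for a stencil family `S` without multiplier rows, `Σ'_{(u,x)} … = cH_j·Σ_κ′ Σ'_{u′} colH G_j Lc l t κ′ u′·I_S(κ′,u′)` with the inner pairing
`I_S(κ′,u′) = Σ'_{(y,w)} Σ_κ″ Σ_a (H_j n)(κ″,y)·dz(φ∘blk) a w·S κ′ u′ y w (inl κ″)(inl a)`.  THIS FILE does the slot sum: `I_S` is uniformly bounded (§1), so for a slot datum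
`h` summable along every direction the family `(t, u′) ↦ h l t·colH G_j Lc l t κ′ u′·I_S(κ′,u′)` is absolutely summable and ONE Fubini step gives
`X_{j+1}(h; n, φ)[S] = cH_j·Σ_κ′ Σ'_{u′} (H_j h)(κ′,u′)·I_S(κ′,u′)`, `H_j h (κ′,u′) = Σ_l Σ'_t h l t·colH G_j Lc l t κ′ u′` (§2).  For the CUBIC member `S := e3OfK Lc G_j S′` of the
next family (`SrecAt (j+1)`'s first sector, weight `cE·wE_{j+1}` stripped) the inner pairing `I_S` IS the integrand of `X_{j+1}[S′]` at the data `(H_{j+1} n, φ∘blk)`, so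
`X^{E}_{j+2}(h; n, φ)[S′] = cH_{j+1}·X_{j+1}(H_{j+1} h; H_{j+1} n, φ∘blk)[S′]` LITERALLY (§3; leaf-06 g49 W-4 «the cubic sector is an X-type pairing one level down»; ENGINE E29∕E31's
recursion `A_J ∝ stepScale_J`).  The class of data is closed under the step: `H_{j+1} h` is again summable along every direction (§1 `summable_fieldResponse`), `H_{j+1} n` and
`φ∘blk` are again bounded.
* §1 `e3OfK_inr_inl_eq_zero` (the cubic member has no multiplier rows), `summable_uncurry_mul_decay_mul_bdd` (a summable weight against a decaying column and a bounded
  factor is absolutely summable on the product), `summable_fieldResponse` (the response of a direction-wise summable datum is direction-wise summable), **`abs_innerPairing_le`** (the inner pairing `I_S` is summable and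
  uniformly bounded in the stencil slot).
* §2 **`slotSum_gaugeLeg_e3OfK_ff`** — the slot sum of PART 3 for ANY local field–field stencil family (every `j`, in-block root, `h` direction-wise summable, bounded `n`, bounded `φ`).
* §3 **`cubicSector_slotSum_eq_levelDown`** (any local `S′`) and **`cubicSector_SrecAt_eq_levelDown`** (`S′ := SrecAt j`): the statement in the title, both sides in B″'s `X` shape.
Asserts NO value of any resolvent column; the border and Λ sectors, the level-one closed form and the pin assembly (⇒ `hX`) are NOT here; NOTHING of (C2′) beyond (δ2b) ∕ `hX` ∕
(W-γ) at levels ≥ 1 ∕ (INV) ∕ (S) discharged; NEVER «G-an2-4 closed» as (CONV-C); NOT D1, NOT `BetaPertH`, NOT continuum, NOT Clay.  2026-08-23; no existing file touched.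
-/

noncomputable section

open Finset
open scoped BigOperators
open Literature.MathematicalPhysics.QuantumFieldTheory
open Literature.MathematicalPhysics.QuantumFieldTheory.Balaban1983to89
open Literature.MathematicalPhysics.QuantumFieldTheory.Balaban1983to89.Beta
open B12Sec2to5 (l1 l1_nonneg)
open ExpKernelCalculus (Site MKer BiLoc Decays Zl Zl_nonneg summable_exp_shift' tsum_exp_shift' l1_sub_symm)
open OneStepResolventKernel (Fib LocStencil)
open AffineAveraging (Form0 Form1 box toSite unitVec dz)
open AveragingContours (blk)
open OneStepKernelFamily (KInvStep colH decays_KInvStep)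
open BalabanStepJetsSucc (mmRead)
open Summit.QuantumFields.BalabanUV.Beta.AxialDressingRooted (coDressKBmAt decays_coDressKBmAt one_le_of_neZero)
open Summit.QuantumFields.BalabanUV.Beta.BorderedHessian (stepScale)
open Summit.QuantumFields.BalabanUV.Beta.SpineRooted (e3OfK e3OfK_apply locStencil_e3OfK)
open Summit.QuantumFields.BalabanUV.Beta.WardLocusRecursive (SrecAt locStencil_SrecAt)
open Summit.QuantumFields.BalabanUV.Beta.GAN24.CoarseGaugeSourceResponse (summable_bdd_mul)
open Summit.QuantumFields.BalabanUV.Beta.GAN24.CubicPushGaugeLegUnfoldingFF (abs_fieldResponse_le' hasSum_prod_gaugeLeg_e3OfK_ff)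

namespace Summit.QuantumFields.BalabanUV.Beta.GAN24.CubicSectorLevelDown

variable {d : ℕ}

/-! ## §1 No multiplier rows in the cubic member; the response of a summable datum; the inner pairing is bounded -/

/-- [folklore] **THE CUBIC MEMBER HAS NO MULTIPLIER ROWS**: `e3OfK N K S κ′ u′ y w (inr m) (inl a) = 0` (the `mm`-read lives in the field–field slot of the next lattice). -/
theorem e3OfK_inr_inl_eq_zero (N : ℕ) (K : MKer (d + 1) (Fib d)) (S : Fin (d + 1) → Site (d + 1) → MKer (d + 1) (Fib d))
    (κ' : Fin (d + 1)) (u' y w : Site (d + 1)) (m a : Fin (d + 1)) :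
    e3OfK N K S κ' u' y w (Sum.inr m) (Sum.inl a) = 0 := by
  rw [e3OfK_apply]
  simp [mmRead]

section Step

variable {Lc : ℕ} [NeZero Lc] {r : Fin (d + 1) → ℕ}

/-- [folklore] **A SUMMABLE WEIGHT AGAINST A DECAYING COLUMN AND A BOUNDED FACTOR IS ABSOLUTELY SUMMABLE ON THE PRODUCT**: for `a` summable, `|c t u′| ≤ C·e^{−δ|u′ − L•t|₁}`
and `|w u′| ≤ B`, the family `(t, u′) ↦ a t·(c t u′·w u′)` is summable on `Site × Site` (fibres `C·Zl(δ)·B·|a t|`, `summable_prod_of_nonneg`). -/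
theorem summable_uncurry_mul_decay_mul_bdd {δG CG B : ℝ} (hδG : 0 < δG) (hCG : 0 ≤ CG) (hB : 0 ≤ B) (L : ℤ)
    {a : Site (d + 1) → ℝ} (ha : Summable a) {c : Site (d + 1) → Site (d + 1) → ℝ}
    (hc : ∀ t u', |c t u'| ≤ CG * Real.exp (-δG * l1 (u' - L • t))) {w : Site (d + 1) → ℝ} (hw : ∀ u', |w u'| ≤ B) :
    Summable (Function.uncurry fun t u' => a t * (c t u' * w u')) := by
  have hfib : ∀ t, Summable fun u' : Site (d + 1) => |a t| * (CG * Real.exp (-δG * l1 (u' - L • t)) * B) :=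
    fun t => (((summable_exp_shift' hδG (L • t)).mul_left CG).mul_right B).mul_left _
  have hmarg : Summable fun t => ∑' u' : Site (d + 1), |a t| * (CG * Real.exp (-δG * l1 (u' - L • t)) * B) := by
    have e : ∀ t, (∑' u' : Site (d + 1), |a t| * (CG * Real.exp (-δG * l1 (u' - L • t)) * B)) = |a t| * (CG * Zl (d + 1) δG * B) := fun t => by
      rw [tsum_mul_left, tsum_mul_right, tsum_mul_left, tsum_exp_shift']
    simp only [e]
    exact ha.abs.mul_right _
  have hg0 : ∀ p : Site (d + 1) × Site (d + 1), 0 ≤ |a p.1| * (CG * Real.exp (-δG * l1 (p.2 - L • p.1)) * B) := fun p => by positivity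
  have hgs : Summable fun p : Site (d + 1) × Site (d + 1) => |a p.1| * (CG * Real.exp (-δG * l1 (p.2 - L • p.1)) * B) :=
    (summable_prod_of_nonneg hg0).2 ⟨hfib, hmarg⟩
  refine Summable.of_norm_bounded hgs (fun p => ?_)
  obtain ⟨t, u'⟩ := p
  rw [Real.norm_eq_abs, Function.uncurry_apply_pair, abs_mul, abs_mul]
  exact mul_le_mul_of_nonneg_left (mul_le_mul (hc t u') (hw u') (abs_nonneg _) (by positivity)) (abs_nonneg _)

/-- [folklore] **THE RESPONSE OF A DIRECTION-WISE SUMMABLE DATUM IS DIRECTION-WISE SUMMABLE** (in-block root, every `j`): if every `h l` is summable, so is every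
`u′ ↦ (H_j h)(κ′, u′) = Σ_l Σ'_t h l t·colH G_j Lc l t κ′ u′` (column mass uniform in the slot). -/
theorem summable_fieldResponse (hr : r ∈ box (d + 1) Lc) (j : ℕ) {h : Form1 (d + 1) ℝ} (hh : ∀ l, Summable (h l)) (κ' : Fin (d + 1)) :
    Summable fun u' : Site (d + 1) => ∑ l, ∑' t : Site (d + 1), h l t * colH (coDressKBmAt (toSite r) Lc (KInvStep (d := d) Lc j)) Lc l t κ' u' := by
  have hLc : 1 ≤ Lc := one_le_of_neZero Lc
  obtain ⟨δ, C, hδ, -, hK⟩ := decays_KInvStep (d := d) (Lc := Lc) j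
  obtain ⟨δG, CG, hδG, hCG, hG⟩ := decays_coDressKBmAt hLc hr (K := KInvStep (d := d) Lc j) ⟨δ, C, hδ, hK.nonneg (Sum.inl 0), hK⟩
  set G : MKer (d + 1) (Fib d) := coDressKBmAt (toSite r) Lc (KInvStep (d := d) Lc j) with hGdef
  refine summable_sum fun l _ => ?_
  -- the family `(t, u′) ↦ h l t·colH G_j Lc l t κ′ u′` is absolutely summable
  have hF : Summable (Function.uncurry fun t u' => h l t * (colH G Lc l t κ' u' * (1 : ℝ))) :=
    summable_uncurry_mul_decay_mul_bdd (d := d) hδG hCG zero_le_one (Lc : ℤ) (hh l) (c := fun t u' => colH G Lc l t κ' u')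
      (fun t u' => hG _ _ _ _) (w := fun _ => (1 : ℝ)) (fun _ => by rw [abs_one])
  have h1 := hF.prod_symm.prod
  refine h1.congr fun u' => ?_
  simp only [Function.uncurry_apply_pair, Prod.swap_prod_mk, mul_one]

/-- NOT IN PRINT; OUR BOOKKEEPING.  **THE INNER PAIRING OF A LOCAL FIELD–FIELD STENCIL FAMILY IS SUMMABLE AND UNIFORMLY BOUNDED IN THE SLOT** (in-block root, every `j`, bounded `n`,
bounded `φ`): `I_S(κ′,u′) = Σ'_{(y,w)} Σ_κ″ Σ_a (H_j n)(κ″,y)·dz(φ∘blk) a w·S κ′ u′ y w (inl κ″)(inl a)` has an absolutely summable integrand and `|I_S(κ′,u′)| ≤ B_I` for all `(κ′,u′)`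
(`H_j n` bounded by PART 3's `abs_fieldResponse_le'`, `|dz(φ∘blk)| ≤ 2Bφ`, the stencil bi-localised at its slot). -/
theorem abs_innerPairing_le (hr : r ∈ box (d + 1) Lc) (j : ℕ)
    {S : Fin (d + 1) → Site (d + 1) → MKer (d + 1) (Fib d)} {Cs δs : ℝ} (hS : LocStencil S Cs δs) (hδs : 0 < δs)
    {n : Form1 (d + 1) ℝ} {Bn : ℝ} (hn : ∀ κ u, |n κ u| ≤ Bn) {φ : Site (d + 1) → ℝ} {Bφ : ℝ} (hφ : ∀ y, |φ y| ≤ Bφ) :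
    ∃ BI : ℝ, 0 ≤ BI ∧ ∀ (κ' : Fin (d + 1)) (u' : Site (d + 1)),
      (Summable fun yw : Site (d + 1) × Site (d + 1) => ∑ κ'' : Fin (d + 1), ∑ a : Fin (d + 1),
          (∑ κ, ∑' u : Site (d + 1), n κ u * colH (coDressKBmAt (toSite r) Lc (KInvStep (d := d) Lc j)) Lc κ u κ'' yw.1)
            * dz (fun x => φ (blk Lc x)) a yw.2 * S κ' u' yw.1 yw.2 (Sum.inl κ'') (Sum.inl a)) ∧
      |∑' yw : Site (d + 1) × Site (d + 1), ∑ κ'' : Fin (d + 1), ∑ a : Fin (d + 1),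
          (∑ κ, ∑' u : Site (d + 1), n κ u * colH (coDressKBmAt (toSite r) Lc (KInvStep (d := d) Lc j)) Lc κ u κ'' yw.1)
            * dz (fun x => φ (blk Lc x)) a yw.2 * S κ' u' yw.1 yw.2 (Sum.inl κ'') (Sum.inl a)| ≤ BI := by
  classical
  have hLc : 1 ≤ Lc := one_le_of_neZero Lc
  set G : MKer (d + 1) (Fib d) := coDressKBmAt (toSite r) Lc (KInvStep (d := d) Lc j) with hGdef
  obtain ⟨BH, hBH0, hHb⟩ := abs_fieldResponse_le' (d := d) hr j hn
  have hBφ : 0 ≤ Bφ := (abs_nonneg _).trans (hφ 0)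
  have hgb : ∀ a w, |dz (fun x => φ (blk Lc x)) a w| ≤ 2 * Bφ := KKTFluctuationEnergy.abs_dz_le (fun x => hφ (blk Lc x))
  have hCs : 0 ≤ Cs := (hS 0 0).nonneg (Sum.inl 0)
  set M : ℝ := ((d + 1 : ℕ) : ℝ) * (((d + 1 : ℕ) : ℝ) * (BH * (2 * Bφ) * Cs)) with hM
  have hM0 : 0 ≤ M := by positivity
  refine ⟨M * (Zl (d + 1) δs * Zl (d + 1) δs), by have := Zl_nonneg (D := d + 1) hδs; positivity, fun κ' u' => ?_⟩
  set Hn : Fin (d + 1) → Site (d + 1) → ℝ := fun κ'' y => ∑ κ, ∑' u : Site (d + 1), n κ u * colH G Lc κ u κ'' y with hHn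
  set F : Site (d + 1) × Site (d + 1) → ℝ := fun yw => ∑ κ'' : Fin (d + 1), ∑ a : Fin (d + 1),
      Hn κ'' yw.1 * dz (fun x => φ (blk Lc x)) a yw.2 * S κ' u' yw.1 yw.2 (Sum.inl κ'') (Sum.inl a) with hF
  set g : Site (d + 1) × Site (d + 1) → ℝ := fun yw => M * (Real.exp (-δs * l1 (yw.1 - u')) * Real.exp (-δs * l1 (yw.2 - u'))) with hg
  have hmaj : HasSum g (M * (Zl (d + 1) δs * Zl (d + 1) δs)) := by
    have h1 := summable_exp_shift' (D := d + 1) hδs u'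
    have h12 := h1.hasSum.mul h1.hasSum (h1.mul_of_nonneg h1 (fun _ => (Real.exp_pos _).le) (fun _ => (Real.exp_pos _).le))
    simp only [tsum_exp_shift'] at h12
    exact h12.mul_left M
  have hterm : ∀ (yw : Site (d + 1) × Site (d + 1)) (κ'' a : Fin (d + 1)),
      |Hn κ'' yw.1 * dz (fun x => φ (blk Lc x)) a yw.2 * S κ' u' yw.1 yw.2 (Sum.inl κ'') (Sum.inl a)|
        ≤ BH * (2 * Bφ) * (Cs * (Real.exp (-δs * l1 (yw.1 - u')) * Real.exp (-δs * l1 (yw.2 - u')))) := by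
    intro yw κ'' a
    rw [abs_mul, abs_mul]
    have e3 : |S κ' u' yw.1 yw.2 (Sum.inl κ'') (Sum.inl a)| ≤ Cs * (Real.exp (-δs * l1 (yw.1 - u')) * Real.exp (-δs * l1 (yw.2 - u'))) := by
      have := hS κ' u' yw.1 yw.2 (Sum.inl κ'') (Sum.inl a)
      rwa [mul_add, Real.exp_add] at this
    exact mul_le_mul (mul_le_mul (hHb κ'' yw.1) (hgb a yw.2) (abs_nonneg _) hBH0) e3 (abs_nonneg _) (by positivity)
  have hle : ∀ yw : Site (d + 1) × Site (d + 1), |F yw| ≤ g yw := by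
    intro yw
    calc |F yw| ≤ ∑ κ'' : Fin (d + 1), |∑ a : Fin (d + 1), Hn κ'' yw.1 * dz (fun x => φ (blk Lc x)) a yw.2 * S κ' u' yw.1 yw.2 (Sum.inl κ'') (Sum.inl a)| :=
          Finset.abs_sum_le_sum_abs _ _
      _ ≤ ∑ κ'' : Fin (d + 1), ∑ a : Fin (d + 1), |Hn κ'' yw.1 * dz (fun x => φ (blk Lc x)) a yw.2 * S κ' u' yw.1 yw.2 (Sum.inl κ'') (Sum.inl a)| :=
          Finset.sum_le_sum fun κ'' _ => Finset.abs_sum_le_sum_abs _ _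
      _ ≤ ∑ _κ'' : Fin (d + 1), ∑ _a : Fin (d + 1), BH * (2 * Bφ) * (Cs * (Real.exp (-δs * l1 (yw.1 - u')) * Real.exp (-δs * l1 (yw.2 - u')))) :=
          Finset.sum_le_sum fun κ'' _ => Finset.sum_le_sum fun a _ => hterm yw κ'' a
      _ = g yw := by
          simp only [Finset.sum_const, Finset.card_univ, Fintype.card_fin, nsmul_eq_mul, hg, hM]; ring
  have hsF : Summable F := Summable.of_norm_bounded hmaj.summable (fun yw => by rw [Real.norm_eq_abs]; exact hle yw)
  refine ⟨hsF, ?_⟩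
  calc |∑' yw : Site (d + 1) × Site (d + 1), F yw| ≤ ∑' yw : Site (d + 1) × Site (d + 1), |F yw| := by
        have h := norm_tsum_le_tsum_norm hsF.norm
        simpa only [Real.norm_eq_abs] using h
    _ ≤ ∑' yw : Site (d + 1) × Site (d + 1), g yw := hsF.abs.tsum_le_tsum hle hmaj.summable
    _ = _ := hmaj.tsum_eq

/-! ## §2 The slot sum of the three-leg unfolding (field–field stencil families) -/

/-- NOT IN PRINT; OUR BOOKKEEPING.  **THE SLOT SUM OF THE THREE-LEG UNFOLDING** (every `j`, in-block root `ρ = toSite r`, any local stencil family `S` with zero `(inr, inl)` blocks, a slot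
datum `h` summable along every direction, bounded `n`, bounded coarse potential `φ`; `G_j = coDressKBmAt ρ Lc (KInvStep Lc j)`, `cH_j = (stepScale_j·Lc^{d+1})⁻¹`,
`H_j h (κ′,u′) = Σ_l Σ'_t h l t·colH G_j Lc l t κ′ u′`, `H_j n (κ″,y) = Σ_κ Σ'_u n κ u·colH G_j Lc κ u κ″ y`):
`Σ_l Σ'_t h l t·Σ'_{(u,x)} Σ_κ Σ_κ₂ n κ u·dzφ κ₂ x·e3OfK Lc G_j S l t u x (inl κ)(inl κ₂) = cH_j·Σ_κ′ Σ'_{u′} (H_j h)(κ′,u′)·Σ'_{(y,w)} Σ_κ″ Σ_a (H_j n)(κ″,y)·dz(φ∘blk Lc) a w·S κ′ u′ y w (inl κ″)(inl a)`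
— PART 3 per slot, then ONE Fubini step `(t, u′)` on the absolutely summable family `h l t·colH G_j Lc l t κ′ u′·I_S(κ′,u′)` (§1: `I_S` uniformly bounded, the column decays from
`Lc•t`, `h l` summable). -/
theorem slotSum_gaugeLeg_e3OfK_ff (hr : r ∈ box (d + 1) Lc) (j : ℕ)
    {S : Fin (d + 1) → Site (d + 1) → MKer (d + 1) (Fib d)} {Cs δs : ℝ} (hS : LocStencil S Cs δs) (hδs : 0 < δs)
    (hff : ∀ κ' u' y w m a, S κ' u' y w (Sum.inr m) (Sum.inl a) = 0)
    {h : Form1 (d + 1) ℝ} (hh : ∀ l, Summable (h l)) {n : Form1 (d + 1) ℝ} {Bn : ℝ} (hn : ∀ κ u, |n κ u| ≤ Bn)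
    {φ : Site (d + 1) → ℝ} {Bφ : ℝ} (hφ : ∀ y, |φ y| ≤ Bφ) :
    ∑ l, ∑' t : Site (d + 1), h l t * ∑' ux : Site (d + 1) × Site (d + 1), ∑ κ, ∑ κ₂, n κ ux.1 * dz φ κ₂ ux.2 *
        e3OfK Lc (coDressKBmAt (toSite r) Lc (KInvStep (d := d) Lc j)) S l t ux.1 ux.2 (Sum.inl κ) (Sum.inl κ₂)
      = (stepScale d Lc j * (Lc : ℝ) ^ (d + 1))⁻¹ *
        ∑ κ', ∑' u' : Site (d + 1), (∑ l, ∑' t : Site (d + 1), h l t * colH (coDressKBmAt (toSite r) Lc (KInvStep (d := d) Lc j)) Lc l t κ' u') *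
          ∑' yw : Site (d + 1) × Site (d + 1), ∑ κ'' : Fin (d + 1), ∑ a : Fin (d + 1),
            (∑ κ, ∑' u : Site (d + 1), n κ u * colH (coDressKBmAt (toSite r) Lc (KInvStep (d := d) Lc j)) Lc κ u κ'' yw.1)
              * dz (fun x => φ (blk Lc x)) a yw.2 * S κ' u' yw.1 yw.2 (Sum.inl κ'') (Sum.inl a) := by
  classical
  have hLc : 1 ≤ Lc := one_le_of_neZero Lc
  set G : MKer (d + 1) (Fib d) := coDressKBmAt (toSite r) Lc (KInvStep (d := d) Lc j) with hGdef
  set cH : ℝ := (stepScale d Lc j * (Lc : ℝ) ^ (d + 1))⁻¹ with hcH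
  obtain ⟨δ, C, hδ, -, hK⟩ := decays_KInvStep (d := d) (Lc := Lc) j
  obtain ⟨δG, CG, hδG, hCG, hG⟩ := decays_coDressKBmAt hLc hr (K := KInvStep (d := d) Lc j) ⟨δ, C, hδ, hK.nonneg (Sum.inl 0), hK⟩
  -- the inner pairings and their uniform bound
  set I : Fin (d + 1) → Site (d + 1) → ℝ := fun κ' u' => ∑' yw : Site (d + 1) × Site (d + 1), ∑ κ'' : Fin (d + 1), ∑ a : Fin (d + 1),
      (∑ κ, ∑' u : Site (d + 1), n κ u * colH G Lc κ u κ'' yw.1) * dz (fun x => φ (blk Lc x)) a yw.2 * S κ' u' yw.1 yw.2 (Sum.inl κ'') (Sum.inl a) with hI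
  obtain ⟨BI, hBI0, hIb⟩ := abs_innerPairing_le (d := d) hr j hS hδs hn hφ
  have hIle : ∀ κ' u', |I κ' u'| ≤ BI := fun κ' u' => (hIb κ' u').2
  -- per slot: PART 3
  have hslot : ∀ (l : Fin (d + 1)) (t : Site (d + 1)),
      (∑' ux : Site (d + 1) × Site (d + 1), ∑ κ, ∑ κ₂, n κ ux.1 * dz φ κ₂ ux.2 * e3OfK Lc G S l t ux.1 ux.2 (Sum.inl κ) (Sum.inl κ₂))
        = cH * ∑ κ', ∑' u' : Site (d + 1), colH G Lc l t κ' u' * I κ' u' := fun l t =>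
    (hasSum_prod_gaugeLeg_e3OfK_ff hr j hS hδs hff l t hn hφ).tsum_eq
  -- the absolutely summable two-index family of one direction pair `(l, κ′)`
  have hF : ∀ l κ', Summable (Function.uncurry fun t u' => h l t * (colH G Lc l t κ' u' * I κ' u')) := fun l κ' =>
    summable_uncurry_mul_decay_mul_bdd (d := d) hδG hCG hBI0 (Lc : ℤ) (hh l) (c := fun t u' => colH G Lc l t κ' u')
      (fun t u' => hG _ _ _ _) (w := fun u' => I κ' u') (hIle κ')
  -- fibre and marginal summabilities
  have hs_t : ∀ l κ', Summable fun t : Site (d + 1) => ∑' u' : Site (d + 1), h l t * (colH G Lc l t κ' u' * I κ' u') := fun l κ' => by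
    simpa only [Function.uncurry_apply_pair] using (hF l κ').prod
  have hs_u : ∀ l κ', Summable fun u' : Site (d + 1) => ∑' t : Site (d + 1), h l t * (colH G Lc l t κ' u' * I κ' u') := fun l κ' => by
    simpa only [Function.uncurry_apply_pair, Prod.swap_prod_mk] using (hF l κ').prod_symm.prod
  -- Step A: per direction `l`, pull `cH` and the finite `κ′`-sum out of the slot series
  have hA : ∀ l, (∑' t : Site (d + 1), h l t * (cH * ∑ κ', ∑' u' : Site (d + 1), colH G Lc l t κ' u' * I κ' u'))
      = cH * ∑ κ', ∑' t : Site (d + 1), ∑' u' : Site (d + 1), h l t * (colH G Lc l t κ' u' * I κ' u') := by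
    intro l
    rw [← Summable.tsum_finsetSum (fun κ' _ => hs_t l κ'), ← tsum_mul_left]
    refine tsum_congr fun t => ?_
    rw [Finset.mul_sum, Finset.mul_sum, Finset.mul_sum]
    refine Finset.sum_congr rfl fun κ' _ => ?_
    rw [tsum_mul_left]
    ring
  -- Step B: the Fubini step and the factorisation of the `t`-series
  have hB : ∀ l κ', (∑' t : Site (d + 1), ∑' u' : Site (d + 1), h l t * (colH G Lc l t κ' u' * I κ' u'))
      = ∑' u' : Site (d + 1), (∑' t : Site (d + 1), h l t * colH G Lc l t κ' u') * I κ' u' := by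
    intro l κ'
    have hc := (hF l κ').tsum_comm
    rw [← hc]
    refine tsum_congr fun u' => ?_
    rw [← tsum_mul_right]
    refine tsum_congr fun t => ?_
    ring
  -- Step C: reassemble the direction sums
  have hsum_u : ∀ l κ', Summable fun u' : Site (d + 1) => (∑' t : Site (d + 1), h l t * colH G Lc l t κ' u') * I κ' u' := by
    intro l κ'
    refine (hs_u l κ').congr fun u' => ?_
    rw [← tsum_mul_right]
    refine tsum_congr fun t => ?_
    ring
  calc (∑ l, ∑' t : Site (d + 1), h l t * ∑' ux : Site (d + 1) × Site (d + 1), ∑ κ, ∑ κ₂, n κ ux.1 * dz φ κ₂ ux.2 *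
          e3OfK Lc G S l t ux.1 ux.2 (Sum.inl κ) (Sum.inl κ₂))
      = ∑ l, ∑' t : Site (d + 1), h l t * (cH * ∑ κ', ∑' u' : Site (d + 1), colH G Lc l t κ' u' * I κ' u') := by
        refine Finset.sum_congr rfl fun l _ => tsum_congr fun t => ?_
        rw [hslot l t]
    _ = ∑ l, cH * ∑ κ', ∑' u' : Site (d + 1), (∑' t : Site (d + 1), h l t * colH G Lc l t κ' u') * I κ' u' := by
        refine Finset.sum_congr rfl fun l _ => ?_
        rw [hA l]
        congr 1
        exact Finset.sum_congr rfl fun κ' _ => hB l κ'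
    _ = cH * ∑ κ', ∑ l, ∑' u' : Site (d + 1), (∑' t : Site (d + 1), h l t * colH G Lc l t κ' u') * I κ' u' := by
        rw [← Finset.mul_sum, Finset.sum_comm]
    _ = cH * ∑ κ', ∑' u' : Site (d + 1), (∑ l, ∑' t : Site (d + 1), h l t * colH G Lc l t κ' u') * I κ' u' := by
        congr 1
        refine Finset.sum_congr rfl fun κ' _ => ?_
        rw [← Summable.tsum_finsetSum (fun l _ => hsum_u l κ')]
        refine tsum_congr fun u' => ?_
        rw [Finset.sum_mul]

/-! ## §3 The cubic sector of the source pairing is the same pairing one level down at the responses -/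

/-- NOT IN PRINT; OUR BOOKKEEPING.  **THE CUBIC SECTOR ONE LEVEL DOWN** (every `j`, in-block root, ANY local stencil family `S′` on the level-`j` lattice, `h` summable along every
direction, bounded `n`, bounded `φ`): with the cubic member `S := e3OfK Lc G_j S′` of the next family (the first sector of `SrecAt (j+1)`, weight `cE·wE_{j+1}` stripped),
`Σ_l Σ'_t h l t·Σ'_{(u,x)} Σ_κ Σ_κ₂ n κ u·dzφ κ₂ x·e3OfK Lc G_{j+1} (e3OfK Lc G_j S′) l t u x (inl κ)(inl κ₂)`
`  = cH_{j+1}·Σ_κ′ Σ'_{u′} (H_{j+1} h)(κ′,u′)·Σ'_{(y,w)} Σ_κ″ Σ_a (H_{j+1} n)(κ″,y)·dz(φ∘blk Lc) a w·e3OfK Lc G_j S′ κ′ u′ y w (inl κ″)(inl a)`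
— the right-hand side is `cH_{j+1}` times B″'s pairing `X_{j+1}[S′]` READ AT THE RESPONSES `(H_{j+1} h; H_{j+1} n, φ∘blk)` (same integrand shape, one level down). -/
theorem cubicSector_slotSum_eq_levelDown (hr : r ∈ box (d + 1) Lc) (j : ℕ)
    {S' : Fin (d + 1) → Site (d + 1) → MKer (d + 1) (Fib d)} {Cs δs : ℝ} (hS' : LocStencil S' Cs δs) (hδs : 0 < δs)
    {h : Form1 (d + 1) ℝ} (hh : ∀ l, Summable (h l)) {n : Form1 (d + 1) ℝ} {Bn : ℝ} (hn : ∀ κ u, |n κ u| ≤ Bn)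
    {φ : Site (d + 1) → ℝ} {Bφ : ℝ} (hφ : ∀ y, |φ y| ≤ Bφ) :
    ∑ l, ∑' t : Site (d + 1), h l t * ∑' ux : Site (d + 1) × Site (d + 1), ∑ κ, ∑ κ₂, n κ ux.1 * dz φ κ₂ ux.2 *
        e3OfK Lc (coDressKBmAt (toSite r) Lc (KInvStep (d := d) Lc (j + 1)))
          (e3OfK Lc (coDressKBmAt (toSite r) Lc (KInvStep (d := d) Lc j)) S') l t ux.1 ux.2 (Sum.inl κ) (Sum.inl κ₂)
      = (stepScale d Lc (j + 1) * (Lc : ℝ) ^ (d + 1))⁻¹ *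
        ∑ κ', ∑' u' : Site (d + 1), (∑ l, ∑' t : Site (d + 1), h l t * colH (coDressKBmAt (toSite r) Lc (KInvStep (d := d) Lc (j + 1))) Lc l t κ' u') *
          ∑' yw : Site (d + 1) × Site (d + 1), ∑ κ'' : Fin (d + 1), ∑ a : Fin (d + 1),
            (∑ κ, ∑' u : Site (d + 1), n κ u * colH (coDressKBmAt (toSite r) Lc (KInvStep (d := d) Lc (j + 1))) Lc κ u κ'' yw.1)
              * dz (fun x => φ (blk Lc x)) a yw.2
              * e3OfK Lc (coDressKBmAt (toSite r) Lc (KInvStep (d := d) Lc j)) S' κ' u' yw.1 yw.2 (Sum.inl κ'') (Sum.inl a) := by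
  have hLc : 1 ≤ Lc := one_le_of_neZero Lc
  obtain ⟨δ, C, hδ, -, hK⟩ := decays_KInvStep (d := d) (Lc := Lc) j
  obtain ⟨δG, CG, hδG, hCG, hG⟩ := decays_coDressKBmAt hLc hr (K := KInvStep (d := d) Lc j) ⟨δ, C, hδ, hK.nonneg (Sum.inl 0), hK⟩
  obtain ⟨C3, δ3, hδ3, h3⟩ := locStencil_e3OfK (N := Lc) hLc ⟨δG, CG, hδG, hCG, hG⟩ hS' hδs
  exact slotSum_gaugeLeg_e3OfK_ff hr (j + 1) h3 hδ3
    (fun κ' u' y w m a => e3OfK_inr_inl_eq_zero Lc _ S' κ' u' y w m a) hh hn hφ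

/-- NOT IN PRINT; OUR BOOKKEEPING.  **THE CUBIC SECTOR OF `X_{j+2}` IS `cH_{j+1}·X_{j+1}` AT THE RESPONSES** — the instance `S′ := SrecAt ρ cE cVH cΛ j` of the previous theorem
(leaf-10's `locStencil_SrecAt`): for every `j`, every weight triple, in-block root, `h` summable along every direction, bounded `n`, bounded `φ`,
`Σ_l Σ'_t h l t·Σ'_{(u,x)} Σ_κ Σ_κ₂ n κ u·dzφ κ₂ x·e3OfK Lc G_{j+1} (e3OfK Lc G_j (SrecAt j)) l t u x (inl κ)(inl κ₂) = cH_{j+1}·X_{j+1}(H_{j+1} h; H_{j+1} n, φ∘blk)`,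
`X_{j+1}` written exactly as in B″ ∕ road-P2's `hX` with the data replaced by the responses.  (The weight `cE·wE_{j+1}` of this sector inside `SrecAt (j+1)`, the border and Λ
sectors and the pin assembly are NOT here.) -/
theorem cubicSector_SrecAt_eq_levelDown (hr : r ∈ box (d + 1) Lc) (cE cVH cΛ : ℝ) (j : ℕ)
    {h : Form1 (d + 1) ℝ} (hh : ∀ l, Summable (h l)) {n : Form1 (d + 1) ℝ} {Bn : ℝ} (hn : ∀ κ u, |n κ u| ≤ Bn)
    {φ : Site (d + 1) → ℝ} {Bφ : ℝ} (hφ : ∀ y, |φ y| ≤ Bφ) :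
    ∑ l, ∑' t : Site (d + 1), h l t * ∑' ux : Site (d + 1) × Site (d + 1), ∑ κ, ∑ κ₂, n κ ux.1 * dz φ κ₂ ux.2 *
        e3OfK Lc (coDressKBmAt (toSite r) Lc (KInvStep (d := d) Lc (j + 1)))
          (e3OfK Lc (coDressKBmAt (toSite r) Lc (KInvStep (d := d) Lc j)) (SrecAt d Lc (toSite r) cE cVH cΛ j)) l t ux.1 ux.2 (Sum.inl κ) (Sum.inl κ₂)
      = (stepScale d Lc (j + 1) * (Lc : ℝ) ^ (d + 1))⁻¹ *
        ∑ κ', ∑' u' : Site (d + 1), (∑ l, ∑' t : Site (d + 1), h l t * colH (coDressKBmAt (toSite r) Lc (KInvStep (d := d) Lc (j + 1))) Lc l t κ' u') *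
          ∑' yw : Site (d + 1) × Site (d + 1), ∑ κ'' : Fin (d + 1), ∑ a : Fin (d + 1),
            (∑ κ, ∑' u : Site (d + 1), n κ u * colH (coDressKBmAt (toSite r) Lc (KInvStep (d := d) Lc (j + 1))) Lc κ u κ'' yw.1)
              * dz (fun x => φ (blk Lc x)) a yw.2
              * e3OfK Lc (coDressKBmAt (toSite r) Lc (KInvStep (d := d) Lc j)) (SrecAt d Lc (toSite r) cE cVH cΛ j) κ' u' yw.1 yw.2 (Sum.inl κ'') (Sum.inl a) := by
  have hLc : 1 ≤ Lc := one_le_of_neZero Lc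
  obtain ⟨Cs, δs, hδs, hS⟩ := locStencil_SrecAt (d := d) hLc hr cE cVH cΛ j
  exact cubicSector_slotSum_eq_levelDown hr j hS hδs hh hn hφ

end Step

end Summit.QuantumFields.BalabanUV.Beta.GAN24.CubicSectorLevelDown

end
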